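import Mathlib
import Literature.Analysis.FluidPDE.KatoSymmetryCovariance
import Summits.NavierStokesRegularity.NavierStokesRegularity.Theorems.L3TimeExponentPincerNoSwirlKatoGlobal
import Summits.NavierStokesRegularity.NavierStokesRegularity.Theorems.L3TimeExponentPincerAxisymmetricRepresentative
import Summits.NavierStokesRegularity.NavierStokesRegularity.Theorems.L3TimeExponentPincerCritModulusNoSwirlReductionSFL3
import HarnessLib.Audit
import HarnessLib

/-!
# L3TimeExponentPincer — `(SFL³-mild)`, `(SFL³)` and the critical modulus `CritSmoothingNoSwirlB` HOLD

Support kernel for the crux `L3CascadeJaw` (item stmt-NavierStokesRegularity-19499) of route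
`L3TimeExponentPincer`: the swirl-free calibration cell of planner nsreg-p2's ROUND-12 («THE
CRITICAL MODULUS») is CLOSED in the kernel.  The three `@[conjecture]` nodes of the cell —
`…Theorems.L3TimeExponentPincerSFL3.SFL3Mild` (the Kato solution from a swirl-free axisymmetric
`L³` datum is global), `…SFL3.SFL3` (swirl-free axisymmetric local Leray solutions with `L³` data
are regular at positive times) and `…L3TimeExponentPincerCritModulus.CritSmoothingNoSwirlB` (a
velocity-indexed critical smoothing modulus `‖u(t)‖_∞ ≤ Φ(‖u₀‖₃) t^{-1/2}` exists in the swirl-free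
Tao class; the memo's «first statement not in print», graded THEOREM-CANDIDATE in Addendum A) —
are PROVED, unconditionally (axioms `propext`, `Classical.choice`, `Quot.sound`):

* `hasGlobalKatoSolution_of_ae_symmetric` — `T_max = ∞` for every weakly divergence-free
  `u₀ ∈ L³` which is a.e. axisymmetric and a.e. swirl-free about some vertical axis `b + ℝ e_z`:
  translate the axis to the origin (`hasGlobalKatoSolution_translate_iff`), symmetrise the
  representative (`exists_isAxisymmetric_hasNoSwirl_ae_eq`: angular mean + poloidal part), and
  apply `hasGlobalKatoSolution_of_ae_eq_isAxisymmetric_hasNoSwirl` (Kato's `L³` theory in the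
  axisymmetric class + Seregin's 2022 local criterion with vanishing swirl, all proved tree
  theorems of the `AxisymmetricKatoGlobal` line, + reflection covariance);
* `sfl3Mild_holds : SFL3Mild`, `sfl3_holds : SFL3` (weak–strong uniqueness + Kato's bound,
  `sfl3_of_sfl3Mild`), **`critSmoothingNoSwirlB_holds : CritSmoothingNoSwirlB`** (the (J)
  reduction `critSmoothingNoSwirlB_of_sfl3Mild`: Jia–Šverák compactness, stability of regularity,
  receding axes);
* `exists_noSwirl_critical_modulus_jaw` — the velocity-indexed swirl-free `L³`-in-time jaw for
  every `q ≥ 0` (finite for `q < 6`), now unconditional.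

As the memo stressed (Addendum A §A.3), the proof is by compactness and yields NO rate: the
EFFECTIVE modulus `CritSmoothingNoSwirlPoly` stays open, and nothing here concerns data WITH
swirl.  WHAT THIS IS NOT: not NS regularity (hard cores 15453 `AxisymmetricKatoGlobal` /
1964 `AxisymSwirlRegular` concern swirl; the full-class modulus `CritSmoothingB`, which WOULD give
the crux, is summit-strength and untouched); the crux `L3CascadeJaw` is untouched; no crux claim.
-/

noncomputable section

open Set MeasureTheory Filter Topology Function Metric TopologicalSpace
open scoped ENNReal NNReal
open Literature.Analysis.FluidPDE

namespace Summit.NavierStokesRegularity.NavierStokesRegularity.Theorems.L3TimeExponentPincerSFL3MildHolds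

open Summit.NavierStokesRegularity.NavierStokesRegularity.Theorems.L3TimeExponentPincerQuantJaw
open Summit.NavierStokesRegularity.NavierStokesRegularity.Theorems.L3TimeExponentPincerCritModulus
open Summit.NavierStokesRegularity.NavierStokesRegularity.Theorems.L3TimeExponentPincerSFL3
open Summit.NavierStokesRegularity.NavierStokesRegularity.Theorems.L3TimeExponentPincerCritModulusNoSwirlReductionSFL3
open Summit.NavierStokesRegularity.NavierStokesRegularity.Theorems.L3TimeExponentPincerNoSwirlKatoGlobal
open Summit.NavierStokesRegularity.NavierStokesRegularity.Theorems.L3TimeExponentPincerAxisymmetricRepresentative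

/-- **`T_max = ∞` for a.e.-symmetric swirl-free `L³` data about any vertical axis.**  Let
`u₀ ∈ L³(ℝ³; ℝ³)` be weakly divergence free, and suppose that for every angle `θ`,
`u₀ (b + R_θ (x - b)) = R_θ (u₀ x)` for a.e. `x`, and `(x - b)₀ (u₀ x)₁ - (x - b)₁ (u₀ x)₀ = 0` for
a.e. `x`.  Then `HasGlobalKatoSolution 1 u₀`. -/
theorem hasGlobalKatoSolution_of_ae_symmetric (b : EuclideanSpace ℝ (Fin 3))
    {u₀ : EuclideanSpace ℝ (Fin 3) → EuclideanSpace ℝ (Fin 3)} (hu₀ : MemLp u₀ 3 volume)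
    (hdiv : IsWeaklyDivFree u₀)
    (hax : ∀ θ : ℝ, ∀ᵐ x ∂volume, u₀ (b + rotZ θ (x - b)) = rotZ θ (u₀ x))
    (hsw : ∀ᵐ x ∂volume, (x - b) 0 * u₀ x 1 - (x - b) 1 * u₀ x 0 = 0) :
    HasGlobalKatoSolution 1 u₀ := by
  -- translate the axis to the origin: `v₀ x = u₀ (x + b)`
  set v₀ : EuclideanSpace ℝ (Fin 3) → EuclideanSpace ℝ (Fin 3) := fun x => u₀ (x - -b) with hv₀
  have hmp : MeasurePreserving (fun x : EuclideanSpace ℝ (Fin 3) => x - -b) volume volume :=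
    measurePreserving_sub_right volume (-b)
  have hv₀3 : MemLp v₀ 3 volume := hu₀.comp_measurePreserving hmp
  have hv₀div : IsWeaklyDivFree v₀ := hdiv.comp_sub_right (-b)
  have e1 : ∀ x : EuclideanSpace ℝ (Fin 3), x - -b - b = x := fun x => by
    rw [sub_neg_eq_add, add_sub_cancel_right]
  have hv₀ax : ∀ θ : ℝ, ∀ᵐ x ∂volume, v₀ (rotZ θ x) = rotZ θ (v₀ x) := fun θ => by
    have h := hmp.quasiMeasurePreserving.ae (hax θ)
    filter_upwards [h] with x hx
    rw [e1] at hx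
    have e2 : rotZ θ x - -b = b + rotZ θ x := by rw [sub_neg_eq_add, add_comm]
    simp only [hv₀]
    rw [e2]
    exact hx
  have hv₀sw : ∀ᵐ x ∂volume, swirl v₀ x = 0 := by
    have h := hmp.quasiMeasurePreserving.ae hsw
    filter_upwards [h] with x hx
    rw [e1] at hx
    simpa only [swirl, hv₀] using hx
  -- symmetrise the representative and apply Kato's theory in the swirl-free class
  obtain ⟨w, hw, hwax, hwsw⟩ := exists_isAxisymmetric_hasNoSwirl_ae_eq hv₀3.1 hv₀ax hv₀sw
  have hG : HasGlobalKatoSolution 1 v₀ :=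
    hasGlobalKatoSolution_of_ae_eq_isAxisymmetric_hasNoSwirl hv₀3 hv₀div hw hwax hwsw
  exact (hasGlobalKatoSolution_translate_iff (-b)).1 hG

/-- **`(SFL³-mild)` holds**: the Kato solution from a swirl-free axisymmetric `L³` datum (a.e.
symmetric about any vertical axis) is global. -/
theorem sfl3Mild_holds : SFL3Mild :=
  sfl3Mild_of_hasGlobalKatoSolution fun b _ hu₀ hdiv hax hsw =>
    hasGlobalKatoSolution_of_ae_symmetric b hu₀ hdiv hax hsw

/-- **`(SFL³)` holds**: swirl-free axisymmetric local Leray solutions (Jia–Šverák class) with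
`L³` data are regular at every point of `(0, ∞) × ℝ³`. -/
theorem sfl3_holds : SFL3 :=
  sfl3_of_sfl3Mild sfl3Mild_holds

/-- **The velocity-indexed critical smoothing modulus in the swirl-free class EXISTS**
(`CritSmoothingNoSwirlB`, planner nsreg-p2 ROUND-12 §2a): there is `Φ : ℝ → ℝ` such that every
Tao-class solution (`ν = 1`) on `[0, T]` from an axisymmetric swirl-free datum with `‖u₀‖₃ ≤ A`
obeys `‖u(t)‖_∞ ≤ Φ(A) t^{-1/2}` for `t ∈ (0, T)`.  By compactness: no rate. -/
theorem critSmoothingNoSwirlB_holds : CritSmoothingNoSwirlB :=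
  critSmoothingNoSwirlB_of_sfl3Mild sfl3Mild_holds

/-- The modulus, in `∃ Φ, CritSmoothingNoSwirl Φ` form. -/
theorem exists_critSmoothingNoSwirl : ∃ Φ : ℝ → ℝ, CritSmoothingNoSwirl Φ :=
  critSmoothingNoSwirlB_holds

/-- **The velocity-indexed swirl-free `L³`-in-time jaw, unconditional** (ROUND-12 §2c currency):
there is `Φ : ℝ → ℝ` such that along every Tao-class swirl-free axisymmetric solution (`ν = 1`)
with `‖u₀‖₃ ≤ A` and energy level `∫|u(t)|² ≤ e` on `(0,T)`, for every `q ≥ 0`,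
`∫₀ᵀ ‖u(t)‖₃^q dt ≤ Φ(A)^{q/3} e^{q/3} ∫₀ᵀ t^{-q/6} dt` (finite for `q < 6`). -/
theorem exists_noSwirl_critical_modulus_jaw :
    ∃ Φ : ℝ → ℝ, ∀ ⦃T A : ℝ⦄, 0 < T → 0 ≤ A →
      ∀ ⦃u₀ : E3 → E3⦄ ⦃u : ℝ → E3 → E3⦄ ⦃p : ℝ → E3 → ℝ⦄,
        IsTaoSolutionOn T 1 u₀ u p → IsAxisymmetric u₀ → HasNoSwirl u₀ →
        eLpNorm u₀ 3 volume ≤ ENNReal.ofReal A →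
        ∀ ⦃e : ℝ≥0∞⦄, e ≠ ⊤ → (∀ t ∈ Ioo 0 T, ∫⁻ x, ‖u t x‖ₑ ^ 2 ≤ e) →
        ∀ ⦃q : ℝ⦄, 0 ≤ q →
          lpTime 3 q T u ≤ ENNReal.ofReal (Φ A) ^ (q / 3) * e ^ (q / 3) *
            ∫⁻ t in Ioo 0 T, ENNReal.ofReal (t ^ (-(1 / 2 : ℝ))) ^ (q / 3) :=
  lpTime_three_le_noSwirl_of_sfl3 sfl3_holds

end Summit.NavierStokesRegularity.NavierStokesRegularity.Theorems.L3TimeExponentPincerSFL3MildHolds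

end
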